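import Summits.CriticalPhenomena.PercolationContinuityZ3.Theorems.PercAnnulusCrossingSlabThm31OfTwo
import Literature.Probability.Percolation.SlabRSWTheorem317
import Literature.Probability.Percolation.SlabBoxCrossingPropertyOfRSW
import HarnessLib

/-!
# NTW 2017, Theorem 3.1 at `p_c(S_k)` from ONE remaining input: Case 3 of Theorem 3.14

(H317) — NTW's Theorem 3.17, the RSW theorem in the high-probability regime — is discharged at `p_c(S_k)` by
the circuit gluing layer (`NTW17.rsw_highProb`, `Literature/…/SlabRSWTheorem317.lean`), its extra input
`inf_n f_{p_c}(2n, n-1) > 0` being supplied by Theorem 3.14 from the Case-3 input itself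
(`thm314_of_cases` + Proposition 3.9 (1), `real_lr_long_ge`).  Hence the box-crossing property at `p_c(S_k)`,
and `NewmanTassionWu2017_thm31`, follow from the Case-3 input (H3) ALONE.

* `hardCrossing_lower_slabCritical_of_case3` — (H3) ⟹ `∃ c₀ > 0, ∀ n ≥ 26, f_{p_c}(2n, n-1) ≥ c₀`.
* `h317_slabCritical_of_case3` — (H3) ⟹ (H317) at `p_c(S_k)` (`m₀ ≥ 52`).
* `boxCrossingProperty_slabCritical_of_one`, **`NewmanTassionWu2017_thm31_of_one`**.
-/

noncomputable section

namespace Summit.CriticalPhenomena.PercolationContinuityZ3.Theorems.Crossing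

open MeasureTheory
open Literature.Probability.Percolation Literature.Probability.LatticeModels
open Literature.Probability.Percolation.NTW17

/-- **`inf_n f_{p_c(S_k)}(2n, n-1) > 0` from Case 3 of Theorem 3.14**: Theorem 3.14 (`thm314_of_cases`, input (3.38) by
`le_real_slabConn_slabCritical`, Case 2 by `thm314_hCase2`) gives `inf f(2n,n) > 0`, and Proposition 3.9 (1)
(`real_lr_long_ge`) gives `f(3N, N) ≥ a₁` for `N ≥ 25`, whence `f(2n, n-1) ≥ f(3(n-1), n-1) ≥ a₁` for `n ≥ 26`.
[cite: NewmanTassionWu2017, Theorem 3.14 with Proposition 3.9 (1)] -/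
theorem hardCrossing_lower_slabCritical_of_case3 (k : ℕ) (hk : 1 ≤ k) {ρ₂ : ℕ} (hρ₂ : 2 ≤ ρ₂)
    (hCase3 : ∀ x : ℝ, 0 < x → ∃ y : ℝ, 0 < y ∧ ∃ n₃ : ℕ, ∀ n : ℕ, n₃ ≤ n →
      x ≤ (bondPercolation (slabGraph 3 k) (criticalProbIOf (slabGraph 3 k) (slabOrigin 3 k))).real
        ((slabConn k (boxR 0 (7 * n) 0 (8 * n - 1)) {z | z.1 = 0} (sideSeg (7 * n) 0 (4 * n - 1)) ∩
            slabConn k (boxR (-(7 * n)) (7 * n) 0 (13 * n - 1)) {z | z.2 = 0} (sideSeg (7 * n) (5 * n) (13 * n - 1))) ∩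
          (slabConn k (boxR (-(7 * n)) (7 * n) 0 (13 * n - 1)) (sideSeg (7 * n) (5 * n) (13 * n - 1))
            (sideSeg (7 * n) 0 (4 * n - 1)))ᶜ ∩ (NTW17.evCase2 k ρ₂ n)ᶜ) →
      y ≤ (bondPercolation (slabGraph 3 k) (criticalProbIOf (slabGraph 3 k) (slabOrigin 3 k))).real
        (slabConn k (boxR 0 (14 * n) 0 (13 * n)) {z | z.1 = 0} {z | z.1 = 14 * n})) :
    ∃ c₀ : ℝ, 0 < c₀ ∧ ∃ n₁ : ℕ, ∀ n : ℕ, n₁ ≤ n →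
      c₀ ≤ crossingProb k (criticalProbIOf (slabGraph 3 k) (slabOrigin 3 k)) (2 * n) (n - 1) := by
  have hpos : 0 < ((criticalProbIOf (slabGraph 3 k) (slabOrigin 3 k) : unitInterval) : ℝ) := by
    show 0 < criticalProb (slabGraph 3 k) (slabOrigin 3 k)
    exact (criticalProb_zd_pos 3 (by norm_num)).trans
      (AizenmanGrimmett1991.criticalProb_zd_lt_criticalProb_slab_of_AG (d := 3) le_rfl k)
  have hlt : ((criticalProbIOf (slabGraph 3 k) (slabOrigin 3 k) : unitInterval) : ℝ) < 1 := by
    show criticalProb (slabGraph 3 k) (slabOrigin 3 k) < 1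
    exact (Transplant.StairSlabLog.criticalProb_slab_le_half k).trans_lt (by norm_num)
  have h338 : ∀ n : ℕ, 1 ≤ n → (1 : ℝ) / 25 ≤
      (bondPercolation (slabGraph 3 k) (criticalProbIOf (slabGraph 3 k) (slabOrigin 3 k))).real
        (slabConn k (boxR 0 n 0 (2 * n)) {z | z.1 = 0} {z | z.1 = n}) :=
    fun n _ => le_real_slabConn_slabCritical k n
  obtain ⟨c₁, hc₁, hRSW⟩ := thm314_of_cases hk (ρ := 4) le_rfl _ hpos hlt (c₀ := 1 / 25) (by norm_num) (by norm_num)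
    h338 (NTW17.evCase2 k ρ₂) (thm314_hCase2 hk hρ₂ _ hpos hlt) hCase3
  have hc₁1 : c₁ ≤ 1 := (hRSW 1 le_rfl).trans measureReal_le_one
  obtain ⟨a, ha0, -, -, hlong⟩ := real_lr_long_ge hk (ρ := 4) le_rfl _ hpos hlt hc₁ hc₁1 hRSW
  refine ⟨a 1, ha0 1, 26, fun n hn => ?_⟩
  have h := hlong 1 (n - 1) (by omega)
  have h3 : a 1 ≤ crossingProb k (criticalProbIOf (slabGraph 3 k) (slabOrigin 3 k)) (3 * (n - 1)) (n - 1) := by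
    rw [crossingProb_eq]
    refine h.trans (le_of_eq ?_)
    have e1 : boxR 0 ((((1 : ℕ) : ℤ) + 2) * ((n - 1 : ℕ) : ℤ)) 0 ((n - 1 : ℕ) : ℤ) =
        boxR 0 ((3 * (n - 1) : ℕ) : ℤ) 0 ((n - 1 : ℕ) : ℤ) := by
      ext z; simp only [mem_boxR_iff]; push_cast; constructor <;> intro hz <;> refine ⟨hz.1, ?_, hz.2.2⟩ <;> linarith [hz.2.1]
    have e2 : {z : ℤ × ℤ | z.1 = (((1 : ℕ) : ℤ) + 2) * ((n - 1 : ℕ) : ℤ)} = {z | z.1 = ((3 * (n - 1) : ℕ) : ℤ)} := by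
      ext z; simp only [Set.mem_setOf_eq]; push_cast; constructor <;> intro hz <;> linarith
    rw [e1, e2]
  exact h3.trans (crossingProb_mono _ (by omega) le_rfl)

/-- **(H317) at `p_c(S_k)` from Case 3 of Theorem 3.14** (`k ≥ 1`, `m₀ ≥ 52`): NTW's Theorem 3.17 at `p = p_c(S_k)` in the
window `ε = p_c(S_k)/2` (`NTW17.rsw_highProb`, circuit gluing layer), its input `inf f(2n,n-1) > 0` supplied by
`hardCrossing_lower_slabCritical_of_case3`. [cite: NewmanTassionWu2017, Theorem 3.17 (at p_c, §3.7)] -/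
theorem h317_slabCritical_of_case3 (k : ℕ) (hk : 1 ≤ k) {ρ₂ : ℕ} (hρ₂ : 2 ≤ ρ₂) {m₀ : ℕ} (hm₀ : 52 ≤ m₀)
    (hCase3 : ∀ x : ℝ, 0 < x → ∃ y : ℝ, 0 < y ∧ ∃ n₃ : ℕ, ∀ n : ℕ, n₃ ≤ n →
      x ≤ (bondPercolation (slabGraph 3 k) (criticalProbIOf (slabGraph 3 k) (slabOrigin 3 k))).real
        ((slabConn k (boxR 0 (7 * n) 0 (8 * n - 1)) {z | z.1 = 0} (sideSeg (7 * n) 0 (4 * n - 1)) ∩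
            slabConn k (boxR (-(7 * n)) (7 * n) 0 (13 * n - 1)) {z | z.2 = 0} (sideSeg (7 * n) (5 * n) (13 * n - 1))) ∩
          (slabConn k (boxR (-(7 * n)) (7 * n) 0 (13 * n - 1)) (sideSeg (7 * n) (5 * n) (13 * n - 1))
            (sideSeg (7 * n) 0 (4 * n - 1)))ᶜ ∩ (NTW17.evCase2 k ρ₂ n)ᶜ) →
      y ≤ (bondPercolation (slabGraph 3 k) (criticalProbIOf (slabGraph 3 k) (slabOrigin 3 k))).real
        (slabConn k (boxR 0 (14 * n) 0 (13 * n)) {z | z.1 = 0} {z | z.1 = 14 * n})) :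
    ∀ η : ℝ, 0 < η →
      (∀ δ : ℝ, 0 < δ → ∃ n : ℕ, 1 ≤ n ∧
        1 - δ ≤ crossingProb k (criticalProbIOf (slabGraph 3 k) (slabOrigin 3 k)) n (2 * n)) →
      ∃ n : ℕ, m₀ ≤ n ∧
        1 - η ≤ crossingProb k (criticalProbIOf (slabGraph 3 k) (slabOrigin 3 k)) (2 * n) (n - 1) := by
  intro η hη hsup
  set pc : ℝ := criticalProb (slabGraph 3 k) (slabOrigin 3 k) with hpc
  have hpos : 0 < pc :=
    (criticalProb_zd_pos 3 (by norm_num)).trans (AizenmanGrimmett1991.criticalProb_zd_lt_criticalProb_slab_of_AG (d := 3) le_rfl k)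
  have hhalf : pc ≤ 1 / 2 := Transplant.StairSlabLog.criticalProb_slab_le_half k
  have hε0 : 0 < pc / 2 := by linarith
  exact rsw_highProb hk hε0 hm₀ (criticalProbIOf (slabGraph 3 k) (slabOrigin 3 k)) (by show pc / 2 ≤ pc; linarith)
    (by show pc ≤ 1 - pc / 2; linarith) (hardCrossing_lower_slabCritical_of_case3 k hk hρ₂ hCase3) hη hsup

/-- **NTW's Theorem 3.1 at `p_c(S_k)` from ONE input**: Case 3 of Theorem 3.14 (against p2's `evCase2`, `ρ₂ ≥ 2`).
[cite: NewmanTassionWu2017, Theorem 3.1 (§3.7) with Theorems 3.8, 3.10, 3.17] -/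
theorem boxCrossingProperty_slabCritical_of_one (k : ℕ) (hk : 1 ≤ k) {ρ₂ : ℕ} (hρ₂ : 2 ≤ ρ₂)
    (hCase3 : ∀ x : ℝ, 0 < x → ∃ y : ℝ, 0 < y ∧ ∃ n₃ : ℕ, ∀ n : ℕ, n₃ ≤ n →
      x ≤ (bondPercolation (slabGraph 3 k) (criticalProbIOf (slabGraph 3 k) (slabOrigin 3 k))).real
        ((slabConn k (boxR 0 (7 * n) 0 (8 * n - 1)) {z | z.1 = 0} (sideSeg (7 * n) 0 (4 * n - 1)) ∩
            slabConn k (boxR (-(7 * n)) (7 * n) 0 (13 * n - 1)) {z | z.2 = 0} (sideSeg (7 * n) (5 * n) (13 * n - 1))) ∩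
          (slabConn k (boxR (-(7 * n)) (7 * n) 0 (13 * n - 1)) (sideSeg (7 * n) (5 * n) (13 * n - 1))
            (sideSeg (7 * n) 0 (4 * n - 1)))ᶜ ∩ (NTW17.evCase2 k ρ₂ n)ᶜ) →
      y ≤ (bondPercolation (slabGraph 3 k) (criticalProbIOf (slabGraph 3 k) (slabOrigin 3 k))).real
        (slabConn k (boxR 0 (14 * n) 0 (13 * n)) {z | z.1 = 0} {z | z.1 = 14 * n})) :
    BoxCrossingProperty k (criticalProbIOf (slabGraph 3 k) (slabOrigin 3 k)) :=
  boxCrossingProperty_slabCritical_of_two k hk hρ₂ (le_refl 52) hCase3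
    (h317_slabCritical_of_case3 k hk hρ₂ (le_refl 52) hCase3)

/-- **`NewmanTassionWu2017_thm31` from ONE input**: Case 3 of Theorem 3.14 for every `k ≥ 1` (`ρ₂ ≥ 2`).
[cite: NewmanTassionWu2017, Theorem 3.1 and §3.7, with Theorems 3.8, 3.10, 3.17] -/
theorem NewmanTassionWu2017_thm31_of_one {ρ₂ : ℕ} (hρ₂ : 2 ≤ ρ₂)
    (hCase3 : ∀ k : ℕ, 1 ≤ k → ∀ x : ℝ, 0 < x → ∃ y : ℝ, 0 < y ∧ ∃ n₃ : ℕ, ∀ n : ℕ, n₃ ≤ n →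
      x ≤ (bondPercolation (slabGraph 3 k) (criticalProbIOf (slabGraph 3 k) (slabOrigin 3 k))).real
        ((slabConn k (boxR 0 (7 * n) 0 (8 * n - 1)) {z | z.1 = 0} (sideSeg (7 * n) 0 (4 * n - 1)) ∩
            slabConn k (boxR (-(7 * n)) (7 * n) 0 (13 * n - 1)) {z | z.2 = 0} (sideSeg (7 * n) (5 * n) (13 * n - 1))) ∩
          (slabConn k (boxR (-(7 * n)) (7 * n) 0 (13 * n - 1)) (sideSeg (7 * n) (5 * n) (13 * n - 1))
            (sideSeg (7 * n) 0 (4 * n - 1)))ᶜ ∩ (NTW17.evCase2 k ρ₂ n)ᶜ) →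
      y ≤ (bondPercolation (slabGraph 3 k) (criticalProbIOf (slabGraph 3 k) (slabOrigin 3 k))).real
        (slabConn k (boxR 0 (14 * n) 0 (13 * n)) {z | z.1 = 0} {z | z.1 = 14 * n})) :
    NewmanTassionWu2017_thm31 :=
  fun k hk => boxCrossingProperty_slabCritical_of_one k hk hρ₂ (hCase3 k hk)

end Summit.CriticalPhenomena.PercolationContinuityZ3.Theorems.Crossing

end
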